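import Literature.NumberTheory.Automorphic.ModularEisensteinContinuation
import HarnessLib

/-!
# The genus-2 theta function `θ_Z(s)` on the Siegel upper half space and its functional equation

Stage 1 of the bottom-up proof of Siegel's volume formula
`Literature.NumberTheory.ModularForms.Siegel1943_vol_F2` (`vol(F₂) = π³/270`,
`Literature/NumberTheory/ModularForms/SiegelFundamentalDomainVolume.lean`; [cite: Klingen1990,
Ch. I §3, closing remark]). In the coordinates `x = (x₁₁, x₁₂, x₂₂, y₁₁, y₁₂, y₂₂) : Fin 6 → ℝ` of
that fact (`Z = X + iY`, `X = (x₀ x₁; x₁ x₂)`, `Y = (x₃ x₄; x₄ x₅)`, `Y > 0` iff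
`0 < x₃ ∧ x₄² < x₃x₅`) we attach to `Z` the positive definite symplectic `4 × 4` matrix
`P_Z = (Y⁻¹, -Y⁻¹X; -XY⁻¹, Y + XY⁻¹X)` of Klingen (I.3 (5): `s = diag(y⁻¹, y)[(1 -x; 0 1)]`,
the image of `z` in the space of positive symplectic matrices, with `s(m⟨z⟩) = s[m⁻¹]`), whose
quadratic form is `P_Z[(a; b)] = Y⁻¹[a - Xb] + Y[b]` (`Sp4Covolume.pForm`), and the theta function
`θ_Z(s) = Σ_{v ∈ ℤ⁴} exp(-π s P_Z[v])` (`Sp4Covolume.siegelTheta`), `s > 0`.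

Main results (everything PROVED, no named facts):

* `Sp4Covolume.kappa_mul_le_pForm` — coercivity `P_Z[v] ≥ κ(Z) ‖v‖²` with an explicit `κ > 0`,
  hence `Sp4Covolume.summable_exp_pForm` (the theta series converges absolutely).
* `Sp4Covolume.tsum_cexp_gauss_shift_freq` — Poisson summation for a Gaussian with shift and
  character, `Σ_n e^{-πA(n-γ)² + 2πiβ(n-γ)} = A^{-1/2} Σ_k e^{-π(k+β)²/A + 2πiγk}`
  (from Mathlib's `Complex.tsum_exp_neg_quadratic`; Gaussian summability over `ℤ` is reused from
  `Literature.NumberTheory.Automorphic.summable_exp_neg_mul_int_sq`).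
* `Sp4Covolume.inner_poisson` — **two-dimensional Poisson summation for a shifted binary Gaussian**:
  `Σ_{a ∈ ℤ²} e^{-πs Y⁻¹[a - c]} = (√det Y / s) Σ_{k ∈ ℤ²} e^{-(π/s) Y[k]} e(k·c)`
  (Poisson in `a₂` after completing the square, then in `a₁`).
* `Sp4Covolume.siegelTheta_eq_mul_tsum` — `θ_Z(s) = (√det Y / s) · Σ_{(b,k) ∈ ℤ² × ℤ²}
  e^{-πs Y[b]} e^{-(π/s) Y[k]} e(bᵀXk)`, a double series symmetric under `(b, k, s) ↔ (k, b, 1/s)`.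
* `Sp4Covolume.siegelTheta_functional_equation` — **`θ_Z(1/s) = s² θ_Z(s)`**: the lattice
  `P_Z^{1/2} ℤ⁴` is unimodular (`det P_Z = 1`) and isometric to its dual (`P_Z⁻¹ = J P_Z Jᵀ`).

Role in the volume computation (Siegel's "theta/Poisson" route, the `n = 2` analogue of
`Literature.NumberTheory.Automorphic.thetaQ_functional_equation` and
`lintegral_fd_thetaQ_sub_one`): with `V = vol(F₂)` and the unfolded value
`∫_{F₂} (θ_Z(s) - 1) dv = ζ(4)/(3πs²)`, integrating the functional equation over `F₂` gives
`ζ(4)s²/(3π) + V = s²(ζ(4)/(3πs²) + V)`, i.e. `V = ζ(4)/(3π) = π³/270`.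

## References

* H. Klingen, *Introductory Lectures on Siegel Modular Forms*, CUP 1990, Ch. I §3 (5)–(6).
  [Klingen1990]
* C. L. Siegel, *Symplectic geometry*, Amer. J. Math. 65 (1943), 1–86.
-/

noncomputable section

namespace Literature.NumberTheory.ModularForms.Sp4Covolume

open Real Complex MeasureTheory Set Filter

/-- `det Y` for `Y = (x₃ x₄; x₄ x₅)`. [folklore] -/
def detY (x : Fin 6 → ℝ) : ℝ := x 3 * x 5 - x 4 ^ 2

/-- `Y[b] = p b₁² + 2q b₁ b₂ + r b₂²`. [folklore] -/
def yForm (x : Fin 6 → ℝ) (b₁ b₂ : ℝ) : ℝ := x 3 * b₁ ^ 2 + 2 * x 4 * b₁ * b₂ + x 5 * b₂ ^ 2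

/-- `Y⁻¹[w] = (r w₁² - 2q w₁ w₂ + p w₂²) / det Y`. [folklore] -/
def yInvForm (x : Fin 6 → ℝ) (w₁ w₂ : ℝ) : ℝ :=
  (x 5 * w₁ ^ 2 - 2 * x 4 * w₁ * w₂ + x 3 * w₂ ^ 2) / detY x

/-- `P_Z[(a; b)] = Y⁻¹[a - X b] + Y[b]`, the quadratic form of the positive symplectic matrix
`P_Z = (Y⁻¹, -Y⁻¹X; -XY⁻¹, Y + XY⁻¹X)` attached to `Z = X + iY` (Klingen I.3 (5)), on
`v = (a₁, a₂, b₁, b₂) ∈ ℤ⁴`. [cite: Klingen1990, Ch. I §3 (5)] -/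
def pForm (x : Fin 6 → ℝ) (v : Fin 4 → ℤ) : ℝ :=
  yInvForm x (v 0 - (x 0 * v 2 + x 1 * v 3)) (v 1 - (x 1 * v 2 + x 2 * v 3)) + yForm x (v 2) (v 3)

/-- The genus-2 theta function `θ_Z(s) = Σ_{v ∈ ℤ⁴} exp(-π s P_Z[v])` of the unimodular lattice
`P_Z^{1/2} ℤ⁴`, `s > 0`. [folklore] -/
def siegelTheta (x : Fin 6 → ℝ) (s : ℝ) : ℝ := ∑' v : Fin 4 → ℤ, Real.exp (-π * s * pForm x v)

section Bounds

variable {x : Fin 6 → ℝ}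

/-- `det Y > 0` on `H₂`. [folklore] -/
theorem detY_pos (hx : 0 < x 3 ∧ x 4 ^ 2 < x 3 * x 5) : 0 < detY x := by
  unfold detY; linarith [hx.2]

/-- `y₂₂ > 0` on `H₂`. [folklore] -/
theorem x5_pos (hx : 0 < x 3 ∧ x 4 ^ 2 < x 3 * x 5) : 0 < x 5 := by
  have h1 : 0 < x 3 * x 5 := lt_of_le_of_lt (sq_nonneg _) hx.2
  exact pos_of_mul_pos_right h1 hx.1.le

/-- `(p + r) Y[b] ≥ det(Y) |b|²` (indeed the difference is `|Yb|²`). [folklore] -/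
theorem detY_mul_le_yForm (x : Fin 6 → ℝ) (b₁ b₂ : ℝ) :
    detY x * (b₁ ^ 2 + b₂ ^ 2) ≤ (x 3 + x 5) * yForm x b₁ b₂ := by
  unfold detY yForm
  nlinarith [sq_nonneg (x 3 * b₁ + x 4 * b₂), sq_nonneg (x 4 * b₁ + x 5 * b₂)]

/-- `(p + r) · adj(Y)[w] ≥ det(Y) |w|²`. [folklore] -/
theorem detY_mul_le_adjForm (x : Fin 6 → ℝ) (w₁ w₂ : ℝ) :
    detY x * (w₁ ^ 2 + w₂ ^ 2) ≤ (x 3 + x 5) * (x 5 * w₁ ^ 2 - 2 * x 4 * w₁ * w₂ + x 3 * w₂ ^ 2) := by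
  unfold detY
  nlinarith [sq_nonneg (x 5 * w₁ - x 4 * w₂), sq_nonneg (-x 4 * w₁ + x 3 * w₂)]

/-- `Y⁻¹[w] ≥ |w|² / (p + r)`. [folklore] -/
theorem sq_le_yInvForm (hx : 0 < x 3 ∧ x 4 ^ 2 < x 3 * x 5) (w₁ w₂ : ℝ) :
    w₁ ^ 2 + w₂ ^ 2 ≤ (x 3 + x 5) * yInvForm x w₁ w₂ := by
  have hD := detY_pos hx
  unfold yInvForm
  rw [mul_div_assoc', le_div_iff₀ hD]
  nlinarith [detY_mul_le_adjForm x w₁ w₂]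

/-- `Y[b] ≥ 0`. [folklore] -/
theorem yForm_nonneg (hx : 0 < x 3 ∧ x 4 ^ 2 < x 3 * x 5) (b₁ b₂ : ℝ) : 0 ≤ yForm x b₁ b₂ := by
  have h := detY_mul_le_yForm x b₁ b₂
  have hD := detY_pos hx
  have h5 := x5_pos hx
  have : 0 ≤ detY x * (b₁ ^ 2 + b₂ ^ 2) := by positivity
  nlinarith [hx.1]

/-- `Y⁻¹[w] ≥ 0`. [folklore] -/
theorem yInvForm_nonneg (hx : 0 < x 3 ∧ x 4 ^ 2 < x 3 * x 5) (w₁ w₂ : ℝ) : 0 ≤ yInvForm x w₁ w₂ := by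
  have h := sq_le_yInvForm hx w₁ w₂
  have h5 := x5_pos hx
  nlinarith [hx.1, sq_nonneg w₁, sq_nonneg w₂]

/-- `P_Z[v] ≥ 0`. [folklore] -/
theorem pForm_nonneg (hx : 0 < x 3 ∧ x 4 ^ 2 < x 3 * x 5) (v : Fin 4 → ℤ) : 0 ≤ pForm x v :=
  add_nonneg (yInvForm_nonneg hx _ _) (yForm_nonneg hx _ _)

/-- The size of `X`: `M = x₀² + 2x₁² + x₂²` bounds `|Xb|² ≤ M |b|²`. [folklore] -/
def xBound (x : Fin 6 → ℝ) : ℝ := x 0 ^ 2 + 2 * x 1 ^ 2 + x 2 ^ 2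

/-- `M ≥ 0`. [folklore] -/
theorem xBound_nonneg (x : Fin 6 → ℝ) : 0 ≤ xBound x := by unfold xBound; positivity

/-- The explicit coercivity constant `κ = det Y / (2 (1 + det Y + 2M)(p + r))`. [folklore] -/
def kappa (x : Fin 6 → ℝ) : ℝ := detY x / (2 * (1 + detY x + 2 * xBound x) * (x 3 + x 5))

/-- `κ > 0`. [folklore] -/
theorem kappa_pos (hx : 0 < x 3 ∧ x 4 ^ 2 < x 3 * x 5) : 0 < kappa x := by
  have hD := detY_pos hx
  have h5 := x5_pos hx
  have hM := xBound_nonneg x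
  have h3 := hx.1
  unfold kappa
  positivity

/-- **Coercivity of `P_Z`**: `P_Z[v] ≥ κ ‖v‖₂²`. [folklore] -/
theorem kappa_mul_le_pForm (hx : 0 < x 3 ∧ x 4 ^ 2 < x 3 * x 5) (v : Fin 4 → ℤ) :
    kappa x * ((v 0 : ℝ) ^ 2 + (v 1 : ℝ) ^ 2 + (v 2 : ℝ) ^ 2 + (v 3 : ℝ) ^ 2) ≤ pForm x v := by
  have hD := detY_pos hx
  have h5 := x5_pos hx
  have h3 := hx.1
  have hM := xBound_nonneg x
  set a₁ : ℝ := ((v 0 : ℤ) : ℝ)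
  set a₂ : ℝ := ((v 1 : ℤ) : ℝ)
  set b₁ : ℝ := ((v 2 : ℤ) : ℝ)
  set b₂ : ℝ := ((v 3 : ℤ) : ℝ)
  set w₁ : ℝ := a₁ - (x 0 * b₁ + x 1 * b₂) with hw₁
  set w₂ : ℝ := a₂ - (x 1 * b₁ + x 2 * b₂) with hw₂
  have hP : pForm x v = yInvForm x w₁ w₂ + yForm x b₁ b₂ := rfl
  -- (i) |w|² + D|b|² ≤ (p+r) P
  have hi : w₁ ^ 2 + w₂ ^ 2 + detY x * (b₁ ^ 2 + b₂ ^ 2) ≤ (x 3 + x 5) * pForm x v := by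
    rw [hP]
    linarith [sq_le_yInvForm hx w₁ w₂, detY_mul_le_yForm x b₁ b₂]
  -- (ii) |a|² ≤ 2|w|² + 2M|b|²
  have hii : a₁ ^ 2 + a₂ ^ 2 ≤ 2 * (w₁ ^ 2 + w₂ ^ 2) + 2 * xBound x * (b₁ ^ 2 + b₂ ^ 2) := by
    have e1 : a₁ = w₁ + (x 0 * b₁ + x 1 * b₂) := by rw [hw₁]; ring
    have e2 : a₂ = w₂ + (x 1 * b₁ + x 2 * b₂) := by rw [hw₂]; ring
    have c1 : (x 0 * b₁ + x 1 * b₂) ^ 2 ≤ (x 0 ^ 2 + x 1 ^ 2) * (b₁ ^ 2 + b₂ ^ 2) := by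
      nlinarith [sq_nonneg (x 0 * b₂ - x 1 * b₁)]
    have c2 : (x 1 * b₁ + x 2 * b₂) ^ 2 ≤ (x 1 ^ 2 + x 2 ^ 2) * (b₁ ^ 2 + b₂ ^ 2) := by
      nlinarith [sq_nonneg (x 1 * b₂ - x 2 * b₁)]
    have s1 : a₁ ^ 2 ≤ 2 * w₁ ^ 2 + 2 * (x 0 * b₁ + x 1 * b₂) ^ 2 := by
      rw [e1]; nlinarith [sq_nonneg (w₁ - (x 0 * b₁ + x 1 * b₂))]
    have s2 : a₂ ^ 2 ≤ 2 * w₂ ^ 2 + 2 * (x 1 * b₁ + x 2 * b₂) ^ 2 := by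
      rw [e2]; nlinarith [sq_nonneg (w₂ - (x 1 * b₁ + x 2 * b₂))]
    unfold xBound
    nlinarith
  -- (iii) combine
  have hiii : detY x * (a₁ ^ 2 + a₂ ^ 2 + b₁ ^ 2 + b₂ ^ 2) ≤
      2 * (1 + detY x + 2 * xBound x) * (w₁ ^ 2 + w₂ ^ 2 + detY x * (b₁ ^ 2 + b₂ ^ 2)) := by
    have hw0 : 0 ≤ w₁ ^ 2 + w₂ ^ 2 := by positivity
    have hb0 : 0 ≤ b₁ ^ 2 + b₂ ^ 2 := by positivity
    have t1 := mul_le_mul_of_nonneg_left hii hD.le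
    have t2 := mul_nonneg hD.le hb0
    have t3 := mul_nonneg hM hw0
    have t4 := mul_nonneg (mul_nonneg hD.le hM) hb0
    have t5 := mul_nonneg (mul_nonneg hD.le hD.le) hb0
    linarith
  have hpos : 0 < 2 * (1 + detY x + 2 * xBound x) * (x 3 + x 5) := by positivity
  unfold kappa
  rw [div_mul_eq_mul_div, div_le_iff₀ hpos]
  calc detY x * (a₁ ^ 2 + a₂ ^ 2 + b₁ ^ 2 + b₂ ^ 2)
      ≤ 2 * (1 + detY x + 2 * xBound x) * (w₁ ^ 2 + w₂ ^ 2 + detY x * (b₁ ^ 2 + b₂ ^ 2)) := hiii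
    _ ≤ 2 * (1 + detY x + 2 * xBound x) * ((x 3 + x 5) * pForm x v) :=
        mul_le_mul_of_nonneg_left hi (by positivity)
    _ = pForm x v * (2 * (1 + detY x + 2 * xBound x) * (x 3 + x 5)) := by ring

end Bounds

section Summability

variable {x : Fin 6 → ℝ}

/-- `ℤ⁴ ≃ (ℤ × ℤ) × (ℤ × ℤ)`, `v ↦ ((b₁, b₂), (a₁, a₂)) = ((v₂, v₃), (v₀, v₁))`. [folklore] -/
def splitEquiv : (Fin 4 → ℤ) ≃ (ℤ × ℤ) × (ℤ × ℤ) where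
  toFun v := ((v 2, v 3), (v 0, v 1))
  invFun p := ![p.2.1, p.2.2, p.1.1, p.1.2]
  left_inv v := by ext i; fin_cases i <;> rfl
  right_inv p := by rfl

/-- Unfolding `splitEquiv.symm`. [folklore] -/
@[simp] theorem splitEquiv_symm_apply (p : (ℤ × ℤ) × (ℤ × ℤ)) :
    splitEquiv.symm p = ![p.2.1, p.2.2, p.1.1, p.1.2] := rfl

/-- Unfolding `splitEquiv`. [folklore] -/
@[simp] theorem splitEquiv_apply (v : Fin 4 → ℤ) : splitEquiv v = ((v 2, v 3), (v 0, v 1)) := rfl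

/-- Gaussian summability over `ℤ²` (product form). [folklore] -/
theorem summable_exp_neg_mul_sq_add_sq {c : ℝ} (hc : 0 < c) :
    Summable fun p : ℤ × ℤ => Real.exp (-c * ((p.1 : ℝ) ^ 2 + (p.2 : ℝ) ^ 2)) := by
  have h1 := Literature.NumberTheory.Automorphic.summable_exp_neg_mul_int_sq hc
  refine (h1.mul_of_nonneg h1 (fun _ => (Real.exp_pos _).le) (fun _ => (Real.exp_pos _).le)).congr
    fun p => ?_
  rw [← Real.exp_add]; congr 1; ring

/-- Gaussian summability over `ℤ⁴` (product form). [folklore] -/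
theorem summable_exp_neg_mul_sum_sq {c : ℝ} (hc : 0 < c) :
    Summable fun v : Fin 4 → ℤ =>
      Real.exp (-c * ((v 0 : ℝ) ^ 2 + (v 1 : ℝ) ^ 2 + (v 2 : ℝ) ^ 2 + (v 3 : ℝ) ^ 2)) := by
  have h2 := summable_exp_neg_mul_sq_add_sq hc
  have h4 : Summable fun p : (ℤ × ℤ) × (ℤ × ℤ) =>
      Real.exp (-c * ((p.1.1 : ℝ) ^ 2 + (p.1.2 : ℝ) ^ 2)) *
        Real.exp (-c * ((p.2.1 : ℝ) ^ 2 + (p.2.2 : ℝ) ^ 2)) :=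
    h2.mul_of_nonneg h2 (fun _ => (Real.exp_pos _).le) (fun _ => (Real.exp_pos _).le)
  rw [← splitEquiv.symm.summable_iff]
  refine h4.congr fun p => ?_
  simp only [Function.comp_apply, splitEquiv_symm_apply, Matrix.cons_val_zero, Matrix.cons_val_one,
    Matrix.cons_val]
  rw [← Real.exp_add]; congr 1; ring

/-- **Summability of the genus-2 theta series** for `s > 0`. [folklore] -/
theorem summable_exp_pForm (hx : 0 < x 3 ∧ x 4 ^ 2 < x 3 * x 5) {s : ℝ} (hs : 0 < s) :
    Summable fun v : Fin 4 → ℤ => Real.exp (-π * s * pForm x v) := by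
  have hκ := kappa_pos hx
  refine Summable.of_nonneg_of_le (fun v => (Real.exp_pos _).le) (fun v => ?_)
    (summable_exp_neg_mul_sum_sq (c := π * s * kappa x) (by positivity))
  refine Real.exp_le_exp.mpr ?_
  have h := kappa_mul_le_pForm hx v
  have : π * s * (kappa x * ((v 0 : ℝ) ^ 2 + (v 1 : ℝ) ^ 2 + (v 2 : ℝ) ^ 2 + (v 3 : ℝ) ^ 2)) ≤
      π * s * pForm x v := mul_le_mul_of_nonneg_left h (by positivity)
  linarith

/-- Complex form of the summability. [folklore] -/
theorem summable_cexp_pForm (hx : 0 < x 3 ∧ x 4 ^ 2 < x 3 * x 5) {s : ℝ} (hs : 0 < s) :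
    Summable fun v : Fin 4 → ℤ => cexp (-π * s * pForm x v : ℝ) := by
  simpa [Complex.ofReal_exp] using Complex.ofRealCLM.summable (summable_exp_pForm hx hs)

/-- The complex form of `θ_Z(s)`. [folklore] -/
theorem siegelTheta_coe (x : Fin 6 → ℝ) (s : ℝ) :
    (siegelTheta x s : ℂ) = ∑' v : Fin 4 → ℤ, cexp (-π * s * pForm x v : ℝ) := by
  unfold siegelTheta
  rw [Complex.ofReal_tsum]
  simp [Complex.ofReal_exp]

end Summability

section Poisson

/-- **Poisson summation for a shifted Gaussian with a character**:
`Σ_n exp(-πA(n-γ)² + 2πiβ(n-γ)) = A^{-1/2} Σ_k exp(-π(k+β)²/A + 2πiγk)`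
(`Complex.tsum_exp_neg_quadratic`). [folklore] -/
theorem tsum_cexp_gauss_shift_freq {A : ℝ} (hA : 0 < A) (γ β : ℝ) :
    ∑' n : ℤ, cexp (-π * A * ((n : ℂ) - γ) ^ 2 + 2 * π * I * β * ((n : ℂ) - γ)) =
      (1 / (Real.sqrt A : ℂ)) * ∑' k : ℤ, cexp (-π * ((k : ℂ) + β) ^ 2 / A + 2 * π * I * γ * k) := by
  have hA' : 0 < ((A : ℝ) : ℂ).re := by simp [hA]
  have h := Complex.tsum_exp_neg_quadratic hA' (A * γ + I * β)
  have e1 : ∀ n : ℤ, cexp (-π * A * ((n : ℂ) - γ) ^ 2 + 2 * π * I * β * ((n : ℂ) - γ)) =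
      cexp (-π * A * γ ^ 2 - 2 * π * I * β * γ) *
        cexp (-π * (A : ℂ) * n ^ 2 + 2 * π * ((A : ℂ) * γ + I * β) * n) := by
    intro n; rw [← Complex.exp_add]; congr 1; ring
  simp_rw [e1]
  rw [tsum_mul_left, h]
  have hsq : ((A : ℝ) : ℂ) ^ (1 / 2 : ℂ) = (Real.sqrt A : ℂ) := by
    rw [Real.sqrt_eq_rpow, Complex.ofReal_cpow hA.le]; norm_num
  rw [hsq, ← (Equiv.neg ℤ).tsum_eq (fun k : ℤ => cexp (-π * ((k : ℂ) + β) ^ 2 / A + 2 * π * I * γ * k))]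
  simp only [Equiv.neg_apply, Int.cast_neg]
  rw [← mul_assoc, mul_comm (cexp _) (1 / (Real.sqrt A : ℂ)), mul_assoc, ← tsum_mul_left]
  congr 1
  refine tsum_congr fun n => ?_
  rw [← Complex.exp_add]
  congr 1
  have hI : I * ((A : ℂ) * γ + I * β) = I * A * γ - β := by
    rw [mul_add, ← mul_assoc I I, Complex.I_mul_I]; ring
  have hAne : ((A : ℝ) : ℂ) ≠ 0 := Complex.ofReal_ne_zero.mpr hA.ne'
  rw [hI]
  field_simp
  linear_combination (-( (A : ℂ) ^ 2 * γ ^ 2)) * Complex.I_sq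

end Poisson

section InnerPoisson

variable {x : Fin 6 → ℝ}

/-- `β = 0` case of `tsum_cexp_gauss_shift_freq`:
`Σ_n exp(-πA(n-γ)²) = A^{-1/2} Σ_k exp(-πk²/A + 2πiγk)`. [folklore] -/
theorem tsum_cexp_gauss_shift {A : ℝ} (hA : 0 < A) (γ : ℝ) :
    ∑' n : ℤ, cexp (-π * A * ((n : ℂ) - γ) ^ 2) =
      (1 / (Real.sqrt A : ℂ)) * ∑' k : ℤ, cexp (-π * (k : ℂ) ^ 2 / A + 2 * π * I * γ * k) := by
  have h := tsum_cexp_gauss_shift_freq hA γ 0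
  simp only [Complex.ofReal_zero, mul_zero, zero_mul, add_zero] at h
  exact h

/-- Shifted Gaussian summability over `ℤ`. [folklore] -/
theorem summable_exp_neg_mul_sub_sq {A : ℝ} (hA : 0 < A) (γ : ℝ) :
    Summable fun n : ℤ => Real.exp (-A * ((n : ℝ) - γ) ^ 2) := by
  have h := (Literature.NumberTheory.Automorphic.summable_exp_neg_mul_int_sq
    (a := A / 2) (by positivity)).mul_left (Real.exp (A * γ ^ 2))
  refine Summable.of_nonneg_of_le (fun n => (Real.exp_pos _).le) (fun n => ?_) h
  rw [← Real.exp_add]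
  refine Real.exp_le_exp.mpr ?_
  nlinarith [sq_nonneg ((n : ℝ) - 2 * γ), hA]

/-- Completing the square in `w₂`:
`-πs Y⁻¹[w] = -π(s/p) w₁² - π(sp/D)(w₂ - (q/p) w₁)²`. [folklore] -/
theorem neg_pi_mul_yInvForm (hx : 0 < x 3 ∧ x 4 ^ 2 < x 3 * x 5) (s w₁ w₂ : ℝ) :
    -π * s * yInvForm x w₁ w₂ =
      -π * (s / x 3) * w₁ ^ 2 - π * (s * x 3 / detY x) * (w₂ - x 4 / x 3 * w₁) ^ 2 := by
  have hD := (detY_pos hx).ne'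
  have h3 := hx.1.ne'
  unfold yInvForm
  set D := detY x with hDdef
  have hr : x 5 = (D + x 4 ^ 2) / x 3 := by rw [hDdef]; unfold detY; field_simp; ring
  rw [hr]
  field_simp
  ring

/-- Summability of the shifted inner family `a ↦ exp(-πs Y⁻¹[a - c])` over `ℤ²`. [folklore] -/
theorem summable_inner (hx : 0 < x 3 ∧ x 4 ^ 2 < x 3 * x 5) {s : ℝ} (hs : 0 < s) (c₁ c₂ : ℝ) :
    Summable fun a : ℤ × ℤ =>
      cexp (-π * s * yInvForm x ((a.1 : ℝ) - c₁) ((a.2 : ℝ) - c₂) : ℝ) := by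
  have h3 := hx.1
  have h5 := x5_pos hx
  set A : ℝ := π * s / (x 3 + x 5) with hA
  have hApos : 0 < A := by positivity
  have hprod : Summable fun a : ℤ × ℤ =>
      Real.exp (-A * ((a.1 : ℝ) - c₁) ^ 2) * Real.exp (-A * ((a.2 : ℝ) - c₂) ^ 2) :=
    (summable_exp_neg_mul_sub_sq hApos c₁).mul_of_nonneg (summable_exp_neg_mul_sub_sq hApos c₂)
      (fun _ => (Real.exp_pos _).le) (fun _ => (Real.exp_pos _).le)
  refine Summable.of_norm_bounded hprod (fun a => ?_)
  rw [Complex.norm_exp, Complex.ofReal_re, ← Real.exp_add]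
  refine Real.exp_le_exp.mpr ?_
  have hb := sq_le_yInvForm hx ((a.1 : ℝ) - c₁) ((a.2 : ℝ) - c₂)
  have : A * (((a.1 : ℝ) - c₁) ^ 2 + ((a.2 : ℝ) - c₂) ^ 2) ≤
      π * s * yInvForm x ((a.1 : ℝ) - c₁) ((a.2 : ℝ) - c₂) := by
    rw [hA, div_mul_eq_mul_div, div_le_iff₀ (by positivity)]
    calc π * s * (((a.1 : ℝ) - c₁) ^ 2 + ((a.2 : ℝ) - c₂) ^ 2)
        ≤ π * s * ((x 3 + x 5) * yInvForm x ((a.1 : ℝ) - c₁) ((a.2 : ℝ) - c₂)) :=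
          mul_le_mul_of_nonneg_left hb (by positivity)
      _ = _ := by ring
  linarith

/-- **Step 1 (Poisson in `a₂`)**: for fixed `a₁`,
`Σ_{a₂} exp(-πs Y⁻¹[(a₁-c₁, a₂-c₂)]) =
  (D/(sp))^{1/2} exp(-π(s/p)(a₁-c₁)²) Σ_{k₂} exp(-π D k₂²/(sp) + 2πi(c₂ + (q/p)(a₁-c₁)) k₂)`. [folklore] -/
theorem inner_step1 (hx : 0 < x 3 ∧ x 4 ^ 2 < x 3 * x 5) {s : ℝ} (hs : 0 < s) (c₁ c₂ : ℝ) (a₁ : ℤ) :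
    ∑' a₂ : ℤ, cexp (-π * s * yInvForm x ((a₁ : ℝ) - c₁) ((a₂ : ℝ) - c₂) : ℝ) =
      (1 / (Real.sqrt (s * x 3 / detY x) : ℂ)) * cexp (-π * (s / x 3) * ((a₁ : ℝ) - c₁) ^ 2 : ℝ) *
        ∑' k₂ : ℤ, cexp (-π * (k₂ : ℂ) ^ 2 / (s * x 3 / detY x : ℝ) +
          2 * π * I * (c₂ + x 4 / x 3 * ((a₁ : ℝ) - c₁) : ℝ) * k₂) := by
  have hD := detY_pos hx
  have h3 := hx.1
  have hA : 0 < s * x 3 / detY x := by positivity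
  have e : ∀ a₂ : ℤ, cexp (-π * s * yInvForm x ((a₁ : ℝ) - c₁) ((a₂ : ℝ) - c₂) : ℝ) =
      cexp (-π * (s / x 3) * ((a₁ : ℝ) - c₁) ^ 2 : ℝ) *
        cexp (-π * (s * x 3 / detY x : ℝ) * ((a₂ : ℂ) - (c₂ + x 4 / x 3 * ((a₁ : ℝ) - c₁) : ℝ)) ^ 2) := by
    intro a₂
    rw [neg_pi_mul_yInvForm hx, ← Complex.exp_add]
    congr 1
    push_cast
    ring
  simp_rw [e]
  rw [tsum_mul_left, tsum_cexp_gauss_shift hA]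
  ring

end InnerPoisson

section InnerPoisson2

variable {x : Fin 6 → ℝ}

/-- The dual term `exp(-(π/s) Y[k]) · e(c·k)`. [folklore] -/
def dualTerm (x : Fin 6 → ℝ) (s c₁ c₂ : ℝ) (k : ℤ × ℤ) : ℂ :=
  cexp (-(π / s * yForm x k.1 k.2) : ℝ) * cexp ((2 * π * (c₁ * k.1 + c₂ * k.2) : ℝ) * I)

/-- The mixed term after the first Poisson step. [folklore] -/
def mixTerm (x : Fin 6 → ℝ) (s c₁ c₂ : ℝ) (a₁ k₂ : ℤ) : ℂ :=
  cexp (-(π * (s / x 3) * ((a₁ : ℝ) - c₁) ^ 2) : ℝ) * cexp (-(π * detY x / (s * x 3) * (k₂ : ℝ) ^ 2) : ℝ) *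
    cexp ((2 * π * (c₂ + x 4 / x 3 * ((a₁ : ℝ) - c₁)) * k₂ : ℝ) * I)

/-- `‖dualTerm‖` is a Gaussian. [folklore] -/
theorem norm_dualTerm (x : Fin 6 → ℝ) (s c₁ c₂ : ℝ) (k : ℤ × ℤ) :
    ‖dualTerm x s c₁ c₂ k‖ = Real.exp (-(π / s * yForm x k.1 k.2)) := by
  unfold dualTerm
  rw [norm_mul, Complex.norm_exp_ofReal_mul_I, mul_one, Complex.norm_exp, Complex.ofReal_re]

/-- `‖mixTerm‖` is a product of two Gaussians. [folklore] -/
theorem norm_mixTerm (x : Fin 6 → ℝ) (s c₁ c₂ : ℝ) (a₁ k₂ : ℤ) :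
    ‖mixTerm x s c₁ c₂ a₁ k₂‖ =
      Real.exp (-(π * (s / x 3)) * ((a₁ : ℝ) - c₁) ^ 2) *
        Real.exp (-(π * detY x / (s * x 3)) * (k₂ : ℝ) ^ 2) := by
  unfold mixTerm
  rw [norm_mul, norm_mul, Complex.norm_exp_ofReal_mul_I, mul_one, Complex.norm_exp, Complex.norm_exp,
    Complex.ofReal_re, Complex.ofReal_re]
  congr 1 <;> congr 1 <;> ring

/-- The dual family is summable. [folklore] -/
theorem summable_dualTerm (hx : 0 < x 3 ∧ x 4 ^ 2 < x 3 * x 5) {s : ℝ} (hs : 0 < s) (c₁ c₂ : ℝ) :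
    Summable (dualTerm x s c₁ c₂) := by
  have h3 := hx.1
  have h5 := x5_pos hx
  have hD := detY_pos hx
  refine Summable.of_norm ?_
  simp_rw [norm_dualTerm]
  set A : ℝ := π / s * (detY x / (x 3 + x 5)) with hA
  have hApos : 0 < A := by positivity
  refine Summable.of_nonneg_of_le (fun _ => (Real.exp_pos _).le) (fun k => ?_)
    (summable_exp_neg_mul_sq_add_sq hApos)
  refine Real.exp_le_exp.mpr ?_
  have hb := detY_mul_le_yForm x (k.1 : ℝ) (k.2 : ℝ)
  have hpos : 0 < x 3 + x 5 := by positivity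
  have h1 : detY x / (x 3 + x 5) * (((k.1 : ℤ) : ℝ) ^ 2 + ((k.2 : ℤ) : ℝ) ^ 2) ≤ yForm x k.1 k.2 := by
    rw [div_mul_eq_mul_div, div_le_iff₀ hpos]
    linarith
  have : A * (((k.1 : ℤ) : ℝ) ^ 2 + ((k.2 : ℤ) : ℝ) ^ 2) ≤ π / s * yForm x k.1 k.2 := by
    rw [hA, mul_assoc]
    exact mul_le_mul_of_nonneg_left h1 (by positivity)
  linarith

/-- The mixed family is summable over `ℤ²`. [folklore] -/
theorem summable_mixTerm (hx : 0 < x 3 ∧ x 4 ^ 2 < x 3 * x 5) {s : ℝ} (hs : 0 < s) (c₁ c₂ : ℝ) :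
    Summable (Function.uncurry (mixTerm x s c₁ c₂)) := by
  have h3 := hx.1
  have hD := detY_pos hx
  refine Summable.of_norm ?_
  have e : ∀ p : ℤ × ℤ, ‖Function.uncurry (mixTerm x s c₁ c₂) p‖ =
      Real.exp (-(π * (s / x 3)) * ((p.1 : ℝ) - c₁) ^ 2) *
        Real.exp (-(π * detY x / (s * x 3)) * ((p.2 : ℝ) - 0) ^ 2) := by
    intro p; rw [Function.uncurry_apply_pair, norm_mixTerm, sub_zero]
  simp_rw [e]
  exact (summable_exp_neg_mul_sub_sq (by positivity) c₁).mul_of_nonneg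
    (summable_exp_neg_mul_sub_sq (by positivity) 0) (fun _ => (Real.exp_pos _).le)
    (fun _ => (Real.exp_pos _).le)

/-- Step 1 restated with `mixTerm`. [folklore] -/
theorem inner_step1' (hx : 0 < x 3 ∧ x 4 ^ 2 < x 3 * x 5) {s : ℝ} (hs : 0 < s) (c₁ c₂ : ℝ) (a₁ : ℤ) :
    ∑' a₂ : ℤ, cexp (-π * s * yInvForm x ((a₁ : ℝ) - c₁) ((a₂ : ℝ) - c₂) : ℝ) =
      (1 / (Real.sqrt (s * x 3 / detY x) : ℂ)) * ∑' k₂ : ℤ, mixTerm x s c₁ c₂ a₁ k₂ := by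
  rw [inner_step1 hx hs, mul_assoc, ← tsum_mul_left]
  congr 1
  refine tsum_congr fun k₂ => ?_
  unfold mixTerm
  rw [mul_assoc, ← Complex.exp_add, ← Complex.exp_add, ← Complex.exp_add]
  congr 1
  have h3 : (x 3 : ℂ) ≠ 0 := Complex.ofReal_ne_zero.mpr hx.1.ne'
  have hs' : (s : ℂ) ≠ 0 := Complex.ofReal_ne_zero.mpr hs.ne'
  have hD : (detY x : ℂ) ≠ 0 := Complex.ofReal_ne_zero.mpr (detY_pos hx).ne'
  push_cast
  field_simp
  ring

/-- Step 2 (Poisson in `a₁`): for fixed `k₂`,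
`Σ_{a₁} mixTerm a₁ k₂ = (s/p)^{-1/2} Σ_{k₁} dualTerm (k₁, k₂)`. [folklore] -/
theorem inner_step2 (hx : 0 < x 3 ∧ x 4 ^ 2 < x 3 * x 5) {s : ℝ} (hs : 0 < s) (c₁ c₂ : ℝ) (k₂ : ℤ) :
    ∑' a₁ : ℤ, mixTerm x s c₁ c₂ a₁ k₂ =
      (1 / (Real.sqrt (s / x 3) : ℂ)) * ∑' k₁ : ℤ, dualTerm x s c₁ c₂ (k₁, k₂) := by
  have h3r := hx.1
  have hA : 0 < s / x 3 := by positivity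
  have h3 : (x 3 : ℂ) ≠ 0 := Complex.ofReal_ne_zero.mpr hx.1.ne'
  have hs' : (s : ℂ) ≠ 0 := Complex.ofReal_ne_zero.mpr hs.ne'
  have hD : (detY x : ℂ) ≠ 0 := Complex.ofReal_ne_zero.mpr (detY_pos hx).ne'
  -- bridge B1
  have e : ∀ a₁ : ℤ, mixTerm x s c₁ c₂ a₁ k₂ =
      (cexp (-(π * detY x / (s * x 3) * (k₂ : ℝ) ^ 2) : ℝ) * cexp ((2 * π * c₂ * k₂ : ℝ) * I)) *
        cexp (-π * (s / x 3 : ℝ) * ((a₁ : ℂ) - c₁) ^ 2 +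
          2 * π * I * (x 4 / x 3 * k₂ : ℝ) * ((a₁ : ℂ) - c₁)) := by
    intro a₁
    unfold mixTerm
    simp only [← Complex.exp_add]
    congr 1
    push_cast
    ring
  simp_rw [e]
  rw [tsum_mul_left, tsum_cexp_gauss_shift_freq hA, ← mul_assoc, mul_comm _ (1 / (Real.sqrt _ : ℂ)),
    mul_assoc, ← tsum_mul_left]
  congr 1
  refine tsum_congr fun k₁ => ?_
  -- bridge B2
  unfold dualTerm
  simp only [← Complex.exp_add]
  congr 1
  set D := detY x with hDdef
  have hr : x 5 = (D + x 4 ^ 2) / x 3 := by rw [hDdef]; unfold detY; field_simp; ring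
  unfold yForm
  rw [hr]
  push_cast
  field_simp
  ring

/-- `(sp/D)^{-1/2} (s/p)^{-1/2} = √D / s`. [folklore] -/
theorem sqrt_consts (hx : 0 < x 3 ∧ x 4 ^ 2 < x 3 * x 5) {s : ℝ} (hs : 0 < s) :
    (1 / (Real.sqrt (s * x 3 / detY x) : ℂ)) * (1 / (Real.sqrt (s / x 3) : ℂ)) =
      ((Real.sqrt (detY x) / s : ℝ) : ℂ) := by
  have h3 := hx.1
  have hD := detY_pos hx
  rw [← Complex.ofReal_one, ← Complex.ofReal_div, ← Complex.ofReal_div, ← Complex.ofReal_mul]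
  congr 1
  rw [div_mul_div_comm, one_mul, ← Real.sqrt_mul (by positivity)]
  have : s * x 3 / detY x * (s / x 3) = s ^ 2 / detY x := by field_simp
  rw [this, Real.sqrt_div' _ hD.le, Real.sqrt_sq hs.le]
  field_simp

/-- **Two-dimensional Poisson summation for the shifted binary Gaussian**:
`Σ_{a ∈ ℤ²} exp(-πs Y⁻¹[a - c]) = (√det Y / s) Σ_{k ∈ ℤ²} exp(-(π/s) Y[k]) e(k·c)`. [folklore] -/
theorem inner_poisson (hx : 0 < x 3 ∧ x 4 ^ 2 < x 3 * x 5) {s : ℝ} (hs : 0 < s) (c₁ c₂ : ℝ) :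
    ∑' a : ℤ × ℤ, cexp (-π * s * yInvForm x ((a.1 : ℝ) - c₁) ((a.2 : ℝ) - c₂) : ℝ) =
      ((Real.sqrt (detY x) / s : ℝ) : ℂ) * ∑' k : ℤ × ℤ, dualTerm x s c₁ c₂ k := by
  rw [(summable_inner hx hs c₁ c₂).tsum_prod]
  simp_rw [inner_step1' hx hs c₁ c₂]
  rw [tsum_mul_left]
  have hcomm := (summable_mixTerm hx hs c₁ c₂).tsum_comm
  rw [← hcomm]
  simp_rw [inner_step2 hx hs c₁ c₂]
  rw [tsum_mul_left, ← mul_assoc, sqrt_consts hx hs]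
  congr 1
  rw [(summable_dualTerm hx hs c₁ c₂).tsum_prod]
  have hcomm2 := (summable_dualTerm hx hs c₁ c₂).tsum_comm (f := fun k₁ k₂ => dualTerm x s c₁ c₂ (k₁, k₂))
  exact hcomm2

end InnerPoisson2

section FunctionalEquation

variable {x : Fin 6 → ℝ}

/-- The symmetric bilinear form `bᵀ X k`. [folklore] -/
def xBil (x : Fin 6 → ℝ) (b k : ℤ × ℤ) : ℝ :=
  x 0 * b.1 * k.1 + x 1 * (b.2 * k.1 + b.1 * k.2) + x 2 * b.2 * k.2

/-- `bᵀXk = kᵀXb` (`X` symmetric). [folklore] -/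
theorem xBil_comm (x : Fin 6 → ℝ) (b k : ℤ × ℤ) : xBil x k b = xBil x b k := by
  unfold xBil; ring

/-- The dual double-series term `exp(-πs Y[b]) exp(-(π/s) Y[k]) e(bᵀXk)`. [folklore] -/
def thetaDual (x : Fin 6 → ℝ) (s : ℝ) (p : (ℤ × ℤ) × (ℤ × ℤ)) : ℂ :=
  cexp (-(π * s * yForm x p.1.1 p.1.2) : ℝ) * cexp (-(π / s * yForm x p.2.1 p.2.2) : ℝ) *
    cexp ((2 * π * xBil x p.1 p.2 : ℝ) * I)

/-- The symmetry `(b, k, s) ↔ (k, b, 1/s)`. [folklore] -/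
theorem thetaDual_swap (x : Fin 6 → ℝ) {s : ℝ} (hs : 0 < s) (p : (ℤ × ℤ) × (ℤ × ℤ)) :
    thetaDual x (1 / s) (p.2, p.1) = thetaDual x s p := by
  unfold thetaDual
  simp only [← Complex.exp_add]
  congr 1
  rw [xBil_comm x p.1 p.2]
  have hs' : (s : ℂ) ≠ 0 := Complex.ofReal_ne_zero.mpr hs.ne'
  push_cast
  field_simp
  ring

/-- `‖thetaDual‖` is a product of two Gaussians. [folklore] -/
theorem norm_thetaDual (x : Fin 6 → ℝ) (s : ℝ) (p : (ℤ × ℤ) × (ℤ × ℤ)) :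
    ‖thetaDual x s p‖ =
      Real.exp (-(π * s * yForm x p.1.1 p.1.2)) * Real.exp (-(π / s * yForm x p.2.1 p.2.2)) := by
  unfold thetaDual
  rw [norm_mul, norm_mul, Complex.norm_exp_ofReal_mul_I, mul_one, Complex.norm_exp, Complex.norm_exp,
    Complex.ofReal_re, Complex.ofReal_re]

/-- Summability of `b ↦ exp(-t Y[b])` over `ℤ²`, `t > 0`. [folklore] -/
theorem summable_exp_neg_yForm (hx : 0 < x 3 ∧ x 4 ^ 2 < x 3 * x 5) {t : ℝ} (ht : 0 < t) :
    Summable fun b : ℤ × ℤ => Real.exp (-(t * yForm x b.1 b.2)) := by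
  have h3 := hx.1
  have h5 := x5_pos hx
  have hD := detY_pos hx
  have hpos : 0 < x 3 + x 5 := by positivity
  set A : ℝ := t * (detY x / (x 3 + x 5)) with hA
  have hApos : 0 < A := by positivity
  refine Summable.of_nonneg_of_le (fun _ => (Real.exp_pos _).le) (fun b => ?_)
    (summable_exp_neg_mul_sq_add_sq hApos)
  refine Real.exp_le_exp.mpr ?_
  have hb := detY_mul_le_yForm x (b.1 : ℝ) (b.2 : ℝ)
  have h1 : detY x / (x 3 + x 5) * (((b.1 : ℤ) : ℝ) ^ 2 + ((b.2 : ℤ) : ℝ) ^ 2) ≤ yForm x b.1 b.2 := by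
    rw [div_mul_eq_mul_div, div_le_iff₀ hpos]
    linarith
  have : A * (((b.1 : ℤ) : ℝ) ^ 2 + ((b.2 : ℤ) : ℝ) ^ 2) ≤ t * yForm x b.1 b.2 := by
    rw [hA, mul_assoc]
    exact mul_le_mul_of_nonneg_left h1 ht.le
  linarith

/-- The dual double series is absolutely summable. [folklore] -/
theorem summable_thetaDual (hx : 0 < x 3 ∧ x 4 ^ 2 < x 3 * x 5) {s : ℝ} (hs : 0 < s) :
    Summable (thetaDual x s) := by
  refine Summable.of_norm ?_
  simp_rw [norm_thetaDual]
  have h1 := summable_exp_neg_yForm hx (t := π * s) (by positivity)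
  have h2 := summable_exp_neg_yForm hx (t := π / s) (by positivity)
  exact h1.mul_of_nonneg h2 (fun _ => (Real.exp_pos _).le) (fun _ => (Real.exp_pos _).le)

/-- The theta summand in split coordinates. [folklore] -/
theorem cexp_pForm_split (x : Fin 6 → ℝ) (s : ℝ) (p : (ℤ × ℤ) × (ℤ × ℤ)) :
    cexp (-π * s * pForm x (splitEquiv.symm p) : ℝ) =
      cexp (-(π * s * yForm x p.1.1 p.1.2) : ℝ) *
        cexp (-π * s * yInvForm x ((p.2.1 : ℝ) - (x 0 * p.1.1 + x 1 * p.1.2))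
          ((p.2.2 : ℝ) - (x 1 * p.1.1 + x 2 * p.1.2)) : ℝ) := by
  rw [← Complex.exp_add, ← Complex.ofReal_add]
  congr 2
  simp only [pForm, splitEquiv_symm_apply, Matrix.cons_val_zero, Matrix.cons_val_one, Matrix.cons_val]
  ring

/-- **`θ_Z(s) = (√det Y / s) · Σ_{(b,k)} thetaDual`**. [folklore] -/
theorem siegelTheta_eq_mul_tsum (hx : 0 < x 3 ∧ x 4 ^ 2 < x 3 * x 5) {s : ℝ} (hs : 0 < s) :
    (siegelTheta x s : ℂ) =
      ((Real.sqrt (detY x) / s : ℝ) : ℂ) * ∑' p : (ℤ × ℤ) × (ℤ × ℤ), thetaDual x s p := by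
  rw [siegelTheta_coe, ← splitEquiv.symm.tsum_eq]
  have hS : Summable fun p : (ℤ × ℤ) × (ℤ × ℤ) => cexp (-π * s * pForm x (splitEquiv.symm p) : ℝ) :=
    (summable_cexp_pForm hx hs).comp_injective splitEquiv.symm.injective
  rw [hS.tsum_prod, (summable_thetaDual hx hs).tsum_prod]
  simp_rw [cexp_pForm_split, tsum_mul_left]
  have e : ∀ b : ℤ × ℤ,
      cexp (-(π * s * yForm x b.1 b.2) : ℝ) *
        ∑' a : ℤ × ℤ, cexp (-π * s * yInvForm x ((a.1 : ℝ) - (x 0 * b.1 + x 1 * b.2))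
          ((a.2 : ℝ) - (x 1 * b.1 + x 2 * b.2)) : ℝ) =
      ((Real.sqrt (detY x) / s : ℝ) : ℂ) * ∑' k : ℤ × ℤ, thetaDual x s (b, k) := by
    intro b
    rw [inner_poisson hx hs, ← mul_assoc, mul_comm (cexp _), mul_assoc, ← tsum_mul_left]
    congr 1
    refine tsum_congr fun k => ?_
    unfold dualTerm thetaDual xBil
    rw [← mul_assoc]
    congr 2
    push_cast
    ring
  simp_rw [e]
  rw [tsum_mul_left]

/-- **The theta functional equation `θ_Z(1/s) = s² θ_Z(s)`** (`det P_Z = 1` and `P_Z⁻¹ = J P_Z Jᵀ`: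
the lattice `P_Z^{1/2} ℤ⁴` is unimodular and isometric to its dual), by Poisson summation in the
`a`-variables and the symmetry of the dual double series. [folklore] -/
theorem siegelTheta_functional_equation (hx : 0 < x 3 ∧ x 4 ^ 2 < x 3 * x 5) {s : ℝ} (hs : 0 < s) :
    siegelTheta x (1 / s) = s ^ 2 * siegelTheta x s := by
  have hs' : 0 < 1 / s := by positivity
  apply Complex.ofReal_injective
  rw [Complex.ofReal_mul, siegelTheta_eq_mul_tsum hx hs', siegelTheta_eq_mul_tsum hx hs,
    ← (Equiv.prodComm (ℤ × ℤ) (ℤ × ℤ)).tsum_eq (thetaDual x (1 / s))]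
  simp only [Equiv.prodComm_apply, Prod.swap, thetaDual_swap x hs]
  rw [← mul_assoc]
  congr 1
  push_cast
  field_simp

end FunctionalEquation

end Literature.NumberTheory.ModularForms.Sp4Covolume
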